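import Summits.AtomisticToContinuum.HydrodynamicLimit.Theorems.LambertianContactSwapLambertianEulerEquilibriumCollisionRate
import Summits.AtomisticToContinuum.HydrodynamicLimit.Theorems.LambertianContactSwapLambertianEulerMarkedKorolyuk
import Summits.AtomisticToContinuum.HydrodynamicLimit.Theorems.LambertianContactSwapLambertianEulerFastPairShell
import HarnessLib

/-!
# The equilibrium floor of the fast-pair collision activity (CAT-core (i))
# (`LambertianContactSwap.LambertianEuler`, stmt-AtomisticToContinuum-11854, line `Sketch`;
# stub `fastPairActivity_equilibrium_le`, assembly of the sub-goals M1 and M3 of lead c9)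

Support file (`--supports stmt-AtomisticToContinuum-11854`).  For `N + 1` hard spheres of diameter
`ε = ε_N = hsDiameter σ N` on `𝕋³` (`0 < σ < 1/2`, `v₁ σ³ ≤ 1/2`) driven by the Lambertian recursion
(`lambertStateAfter = z_m`, `lambertInstant = t_m`, `lambertCount = K`, `lambertFlow = Λ`, noise
`ξs ∼ γ^ℕ = lambertNoise`), and the equilibrium law `G_N = localGibbsLaw σ b w ϑ N Φ` with CONSTANT
profiles `b, ϑ > 0`, `w`, put `μ := G_N ⊗ γ^ℕ`.  The `ε`-weighted kinetic content of the FAST incoming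
pairs (`V² < 1 + ‖v_i‖² + ‖v_l‖²`) over the contacts of a window `(a', a' + h]`,

  `T(z, ξs) = Σ_{m < K_{a'+h}, a' < t_{m+1}} Σ_q 𝟙{q ∈ incomingPairs z_m♭} 𝟙{V² < 1 + ‖v_{q.1}‖² + ‖v_{q.2}‖²}
      · ε (1 + ‖v_{q.1}‖² + ‖v_{q.2}‖²)`   (velocities of `z_m`),

satisfies `∫⁻ T dμ ≤ A e^{−aV²} σ³ h (N+1)` with `A, a > 0` depending on `w, ϑ` only — for ALL `N`,
`Φ`, `V ≥ 1` and all windows.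

## Proof (Campbell's bound for a marked point process, via the marked Korolyuk inequality)

* PATHWISE (M1, `…MarkedKorolyuk.markedContacts_le_meshSum`): on `μ`-a.e. path (simple instants —
  `…SimpleCollisions.ae_freeExitTime_lambertStateAfter_pos`; no accumulation —
  `…RestartInLaw.ae_nonAccumulation_of_absolutelyContinuous`; simple incoming exits from the domain —
  `…FwdGood.lambert_ae_fwdGood`, all transferred along `G_N ≪ liouville`), eventually in the mesh
  `h' = h/(n+1)`, `T ≤ R_n := Σ_{j ≤ n} Σ_q F_{h'}(q, Λ_{a' + j h'})` with the shell-marked summand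
  `F_δ(q, y) = 𝟙{q.1 ≠ q.2, ε ≤ d_q(y) ≤ ε + δ ‖Δv_q(y)‖} · (mark of q at y)`.
* FATOU: `∫⁻ T ≤ ∫⁻ liminf_n R_n ≤ liminf_n ∫⁻ R_n` (`lintegral_liminf_le`; `R_n` is jointly measurable,
  `measurable_meshSum`).
* STATIONARITY (`…Liouville.gibbsInvarianceLambda_holds`: `μ ∘ Λ_s⁻¹ = G_N`, `lintegral_meshSum_le`)
  and STATICS (M3, `…FastPairShell.lintegral_fastPairShell_le`): each of the `(n+1)(N+1)²` terms of
  `∫⁻ R_n` is `≤ ε (A e^{−aV²} ε² h' + C₂ h'²)`, so `∫⁻ R_n ≤ (N+1)² ε (A e^{−aV²} ε² h + C₂ h²/(n+1))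
  → (N+1)² ε³ A e^{−aV²} h = A e^{−aV²} σ³ h (N+1)` (`(N+1) ε³ = σ³`, `succ_mul_hsDiameter_pow_three`).

References: Daley–Vere-Jones, *An Introduction to the Theory of Point Processes* I, §3.3 and §6.4
(Korolyuk, Campbell); Cercignani–Illner–Pulvirenti 1994, §2.2.  All statements [folklore] given the
landed sub-goals.
-/

noncomputable section

namespace Summit.AtomisticToContinuum.HydrodynamicLimit.Theorems.LambertianContactSwapLambertianEulerFastPairActivity

open scoped BigOperators Topology ENNReal InnerProductSpace
open MeasureTheory ProbabilityTheory Filter Set InformationTheory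
open Literature.MathematicalPhysics.KineticTheory
open Literature.Analysis.FluidPDE Literature.Analysis.FluidPDE.Alexander
open Summit.AtomisticToContinuum.HydrodynamicLimit.Theorems.LambertianContactSwapLambertianEulerEquilibriumCountStationarity
open Summit.AtomisticToContinuum.HydrodynamicLimit.Theorems.LambertianContactSwapLambertianEulerEquilibriumCollisionRate
open Summit.AtomisticToContinuum.HydrodynamicLimit.Theorems.LambertianContactSwapLambertianEulerSimpleCollisions
open Summit.AtomisticToContinuum.HydrodynamicLimit.Theorems.LambertianContactSwapLambertianEulerRestartInLaw
open Summit.AtomisticToContinuum.HydrodynamicLimit.Theorems.LambertianContactSwapLambertianEulerLiouville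
open Summit.AtomisticToContinuum.HydrodynamicLimit.Theorems.LambertianContactSwapLambertianEulerMarkedKorolyuk
open Summit.AtomisticToContinuum.HydrodynamicLimit.Theorems.LambertianContactSwapLambertianEulerFastPairShell

/-! ## Mesh sums of a mark read on the Lambertian flow: measurability and mean at equilibrium -/

/-- **A mesh sum is jointly measurable**: for marks `F q` measurable in the configuration and mesh times
`s j`, `(z, ξs) ↦ Σ_{j ≤ n} Σ_q F q (Λ_{s j}(z, ξs))` is measurable (`measurable_lambertFlow_hsDiameter`).
[folklore] -/
theorem measurable_meshSum {σ : ℝ} (hσ : 0 ≤ σ) (hσ' : σ < 2⁻¹) (N : ℕ)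
    {F : Fin (N + 1) × Fin (N + 1) → Config (N + 1) (Fin 3) T3 → ℝ} (hFm : ∀ q, Measurable fun y => F q y)
    (s : ℕ → ℝ) (n : ℕ) :
    Measurable fun p : Config (N + 1) (Fin 3) T3 × (ℕ → V3) =>
      ∑ j ∈ Finset.range (n + 1), ∑ q : Fin (N + 1) × Fin (N + 1),
        F q (lambertFlow (Torus.geometry (Fin 3)) (hsDiameter σ N) p.2 p.1 (s j)) :=
  Finset.measurable_sum _ fun j _ => Finset.measurable_sum _ fun q _ =>
    (hFm q).comp (measurable_lambertFlow_hsDiameter hσ hσ' N (s j))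

/-- **One-time stationarity of the equilibrium law, `lintegral` form**: for `s ≥ 0` and measurable
`f ≥ 0`, `∫⁻ f(Λ_s) d(G_N ⊗ γ^ℕ) = ∫⁻ f dG_N` (`lintegral_map` and `gibbsInvarianceLambda_holds`).
[folklore] -/
theorem lintegral_comp_lambertFlow_eq {σ : ℝ} (hσ : 0 < σ) (hσ' : σ < 2⁻¹) (N : ℕ) (b ϑ : ℝ) (w : V3)
    (hb : 0 < b) (hϑ : 0 < ϑ) (Φ : HardSphereFlow (Torus.geometry (Fin 3)) (hsDiameter σ N) (N + 1))
    {f : Config (N + 1) (Fin 3) T3 → ℝ≥0∞} (hf : Measurable f) {s : ℝ} (hs : 0 ≤ s) :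
    ∫⁻ p, f (lambertFlow (Torus.geometry (Fin 3)) (hsDiameter σ N) p.2 p.1 s)
        ∂((localGibbsLaw σ (fun _ => b) (fun _ => w) (fun _ => ϑ) N Φ).prod (lambertNoise (Fin 3))) =
      ∫⁻ y, f y ∂(localGibbsLaw σ (fun _ => b) (fun _ => w) (fun _ => ϑ) N Φ) := by
  have h := lintegral_map
    (μ := (localGibbsLaw σ (fun _ => b) (fun _ => w) (fun _ => ϑ) N Φ).prod (lambertNoise (Fin 3)))
    hf (measurable_lambertFlow_hsDiameter hσ.le hσ' N s)
  rw [gibbsInvarianceLambda_holds σ hσ hσ' N b ϑ w hb hϑ Φ s hs] at h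
  exact h.symm

/-- **The mean of a mesh sum at equilibrium**: if the nonnegative measurable marks `F q` all have
`∫⁻ F q dG_N ≤ B` and the mesh times are `s j ≥ 0`, then
`∫⁻ Σ_{j ≤ n} Σ_q F q (Λ_{s j}) d(G_N ⊗ γ^ℕ) ≤ (n+1) (N+1)² B` — the `(n+1)(N+1)²` terms are transported
to `G_N` by stationarity (`lintegral_comp_lambertFlow_eq`). [folklore] -/
theorem lintegral_meshSum_le {σ : ℝ} (hσ : 0 < σ) (hσ' : σ < 2⁻¹) (N : ℕ) (b ϑ : ℝ) (w : V3)
    (hb : 0 < b) (hϑ : 0 < ϑ) (Φ : HardSphereFlow (Torus.geometry (Fin 3)) (hsDiameter σ N) (N + 1))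
    {F : Fin (N + 1) × Fin (N + 1) → Config (N + 1) (Fin 3) T3 → ℝ} (hF0 : ∀ q y, 0 ≤ F q y)
    (hFm : ∀ q, Measurable fun y => F q y) {B : ℝ}
    (hB : ∀ q : Fin (N + 1) × Fin (N + 1),
      ∫⁻ y, ENNReal.ofReal (F q y) ∂(localGibbsLaw σ (fun _ => b) (fun _ => w) (fun _ => ϑ) N Φ) ≤
        ENNReal.ofReal B)
    {s : ℕ → ℝ} (hs : ∀ j, 0 ≤ s j) (n : ℕ) :
    ∫⁻ p, ENNReal.ofReal (∑ j ∈ Finset.range (n + 1), ∑ q : Fin (N + 1) × Fin (N + 1),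
        F q (lambertFlow (Torus.geometry (Fin 3)) (hsDiameter σ N) p.2 p.1 (s j)))
        ∂((localGibbsLaw σ (fun _ => b) (fun _ => w) (fun _ => ϑ) N Φ).prod (lambertNoise (Fin 3))) ≤
      ENNReal.ofReal (((n : ℝ) + 1) * (((N : ℝ) + 1) ^ 2 * B)) := by
  set G := localGibbsLaw σ (fun _ => b) (fun _ => w) (fun _ => ϑ) N Φ with hGdef
  have hm : ∀ (j : ℕ) (q : Fin (N + 1) × Fin (N + 1)),
      Measurable fun p : Config (N + 1) (Fin 3) T3 × (ℕ → V3) =>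
        ENNReal.ofReal (F q (lambertFlow (Torus.geometry (Fin 3)) (hsDiameter σ N) p.2 p.1 (s j))) :=
    fun j q => ((hFm q).comp (measurable_lambertFlow_hsDiameter hσ.le hσ' N _)).ennreal_ofReal
  calc ∫⁻ p, ENNReal.ofReal (∑ j ∈ Finset.range (n + 1), ∑ q : Fin (N + 1) × Fin (N + 1),
          F q (lambertFlow (Torus.geometry (Fin 3)) (hsDiameter σ N) p.2 p.1 (s j))) ∂(G.prod (lambertNoise (Fin 3)))
      = ∫⁻ p, ∑ j ∈ Finset.range (n + 1), ∑ q : Fin (N + 1) × Fin (N + 1),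
          ENNReal.ofReal (F q (lambertFlow (Torus.geometry (Fin 3)) (hsDiameter σ N) p.2 p.1 (s j)))
          ∂(G.prod (lambertNoise (Fin 3))) := by
        refine lintegral_congr fun p => ?_
        rw [ENNReal.ofReal_sum_of_nonneg fun j _ => Finset.sum_nonneg fun q _ => hF0 _ _]
        exact Finset.sum_congr rfl fun j _ => ENNReal.ofReal_sum_of_nonneg fun q _ => hF0 _ _
    _ = ∑ j ∈ Finset.range (n + 1), ∑ q : Fin (N + 1) × Fin (N + 1),
          ∫⁻ p, ENNReal.ofReal (F q (lambertFlow (Torus.geometry (Fin 3)) (hsDiameter σ N) p.2 p.1 (s j)))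
            ∂(G.prod (lambertNoise (Fin 3))) := by
        rw [lintegral_finsetSum _ fun j _ => Finset.measurable_sum _ fun q _ => hm j q]
        exact Finset.sum_congr rfl fun j _ => lintegral_finsetSum _ fun q _ => hm j q
    _ = ∑ _j ∈ Finset.range (n + 1), ∑ q : Fin (N + 1) × Fin (N + 1), ∫⁻ y, ENNReal.ofReal (F q y) ∂G :=
        Finset.sum_congr rfl fun j _ => Finset.sum_congr rfl fun q _ =>
          lintegral_comp_lambertFlow_eq hσ hσ' N b ϑ w hb hϑ Φ (hFm q).ennreal_ofReal (hs j)
    _ ≤ ∑ _j ∈ Finset.range (n + 1), ∑ _q : Fin (N + 1) × Fin (N + 1), ENNReal.ofReal B :=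
        Finset.sum_le_sum fun j _ => Finset.sum_le_sum fun q _ => hB q
    _ = ENNReal.ofReal (((n : ℝ) + 1) * (((N : ℝ) + 1) ^ 2 * B)) := by
        simp only [Finset.sum_const, Finset.card_univ, Fintype.card_prod, Fintype.card_fin,
          Finset.card_range, nsmul_eq_mul, natCast_mul_ofReal]
        congr 1
        push_cast
        ring

/-! ## The registered stub -/

/-- **M4. THE EQUILIBRIUM FLOOR OF CAT-core (i)** (registered stub `fastPairActivity_equilibrium_le` of
stmt-11854, line `Sketch`): for constant profiles `b, ϑ > 0`, `w` there are `A, a > 0` such that for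
`0 < σ < 1/2` with `v₁ σ³ ≤ 1/2`, ALL `N`, `Φ`, `V ≥ 1` and windows `0 ≤ a'`, `0 < h`, the
`ε_N`-weighted kinetic content of the fast incoming contact pairs of the window `(a', a'+h]` has
`G_N ⊗ γ^ℕ`-mean `≤ A e^{−aV²} σ³ h (N+1)` — the pathwise marked Korolyuk inequality (M1) a.e., Fatou,
one-time stationarity of `G_N` under `Λ`, the static fast-pair shell with Gaussian weights (M3), and
`(N+1) ε_N³ = σ³`. [folklore] -/
theorem fastPairActivity_equilibrium_le :
    ∀ (b ϑ : ℝ) (w : V3), 0 < b → 0 < ϑ → ∃ A a : ℝ, 0 < A ∧ 0 < a ∧ ∀ σ : ℝ, 0 < σ → σ < 2⁻¹ → v₁ * σ ^ 3 ≤ 1 / 2 →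
      ∀ (N : ℕ) (Φ : HardSphereFlow (Torus.geometry (Fin 3)) (hsDiameter σ N) (N + 1)) (V : ℝ), 1 ≤ V →
        ∀ (a' h : ℝ), 0 ≤ a' → 0 < h →
          ∫⁻ p, ENNReal.ofReal
              (∑ m ∈ Finset.range (lambertCount (Torus.geometry (Fin 3)) (hsDiameter σ N) p.2 p.1 (a' + h)),
                if a' < (lambertInstant (Torus.geometry (Fin 3)) (hsDiameter σ N) p.2 p.1 (m + 1)).toReal then
                  ∑ q : Fin (N + 1) × Fin (N + 1),
                    (incomingPairs (Torus.geometry (Fin 3)) (hsDiameter σ N)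
                      (freeFlight (Torus.geometry (Fin 3))
                        (freeExitTime (Torus.geometry (Fin 3)) (hsDiameter σ N)
                          (lambertStateAfter (Torus.geometry (Fin 3)) (hsDiameter σ N) p.2 p.1 m)).toReal
                        (lambertStateAfter (Torus.geometry (Fin 3)) (hsDiameter σ N) p.2 p.1 m))).indicator
                      (fun q' => if V ^ 2 < 1 + ‖(lambertStateAfter (Torus.geometry (Fin 3)) (hsDiameter σ N) p.2 p.1 m q'.1).2‖ ^ 2 +
                            ‖(lambertStateAfter (Torus.geometry (Fin 3)) (hsDiameter σ N) p.2 p.1 m q'.2).2‖ ^ 2 then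
                          hsDiameter σ N * (1 + ‖(lambertStateAfter (Torus.geometry (Fin 3)) (hsDiameter σ N) p.2 p.1 m q'.1).2‖ ^ 2 +
                            ‖(lambertStateAfter (Torus.geometry (Fin 3)) (hsDiameter σ N) p.2 p.1 m q'.2).2‖ ^ 2) else 0) q
                else 0)
            ∂((localGibbsLaw σ (fun _ => b) (fun _ => w) (fun _ => ϑ) N Φ).prod (lambertNoise (Fin 3))) ≤
          ENNReal.ofReal (A * Real.exp (-(a * V ^ 2)) * σ ^ 3 * h * ((N : ℝ) + 1)) := by
  intro b ϑ w hb hϑ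
  obtain ⟨A, a, hA, ha, H3⟩ := lintegral_fastPairShell_le b ϑ w hb hϑ
  refine ⟨A, a, hA, ha, ?_⟩
  intro σ hσ hσ' hv N Φ V hV a' h ha' hh
  obtain ⟨C₂, hC₂, Hs⟩ := H3 σ hσ hσ' hv N Φ
  haveI := isProbabilityMeasure_localGibbsLaw_const hσ' N w hb hϑ Φ
  -- notation
  set G := localGibbsLaw σ (fun _ => b) (fun _ => w) (fun _ => ϑ) N Φ with hGdef
  set μ : Measure (Config (N + 1) (Fin 3) T3 × (ℕ → V3)) := G.prod (lambertNoise (Fin 3)) with hμ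
  have hε : 0 < hsDiameter σ N := hsDiameter_pos hσ N
  have hε' : hsDiameter σ N < 2⁻¹ := (hsDiameter_le hσ.le N).trans_lt hσ'
  have hGac : G ≪ liouville (Torus.geometry (Fin 3)) (N + 1) (hsDiameter σ N) :=
    localGibbsLaw_absolutelyContinuous σ _ _ _ N Φ
  -- Step 0: the mark `wt` (fast-pair kinetic content: nonnegative, velocity-only, measurable) and the
  -- shell-marked summand `F δ` (nonnegative, measurable, of small `G`-mean by the statics M3)
  set wt : Fin (N + 1) × Fin (N + 1) → Config (N + 1) (Fin 3) T3 → ℝ := fun q y =>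
    if V ^ 2 < 1 + ‖(y q.1).2‖ ^ 2 + ‖(y q.2).2‖ ^ 2 then
      hsDiameter σ N * (1 + ‖(y q.1).2‖ ^ 2 + ‖(y q.2).2‖ ^ 2) else 0 with hwt
  set F : ℝ → Fin (N + 1) × Fin (N + 1) → Config (N + 1) (Fin 3) T3 → ℝ := fun δ q y =>
    if q.1 ≠ q.2 ∧ hsDiameter σ N ≤ ‖(Torus.geometry (Fin 3)).sepVec (y q.1).1 (y q.2).1‖ ∧
        ‖(Torus.geometry (Fin 3)).sepVec (y q.1).1 (y q.2).1‖ ≤ hsDiameter σ N + δ * ‖(y q.1).2 - (y q.2).2‖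
      then wt q y else 0 with hF
  have hwt0 : ∀ q y, 0 ≤ wt q y := by
    intro q y
    simp only [hwt]
    split_ifs
    · exact mul_nonneg hε.le (by positivity)
    · exact le_rfl
  have hwtv : ∀ q (y y' : Config (N + 1) (Fin 3) T3), (∀ i, (y i).2 = (y' i).2) → wt q y = wt q y' := by
    intro q y y' hv
    simp only [hwt, hv]
  have hwtm : ∀ q, Measurable fun y => wt q y := by
    intro q
    have hk : Measurable fun y : Config (N + 1) (Fin 3) T3 => 1 + ‖(y q.1).2‖ ^ 2 + ‖(y q.2).2‖ ^ 2 :=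
      (measurable_const.add ((measurable_pi_apply q.1).snd.norm.pow_const 2)).add
        ((measurable_pi_apply q.2).snd.norm.pow_const 2)
    simp only [hwt]
    exact Measurable.ite (measurableSet_lt measurable_const hk) (hk.const_mul _) measurable_const
  have hF0 : ∀ δ q y, 0 ≤ F δ q y := by
    intro δ q y
    simp only [hF]
    split_ifs
    · exact hwt0 q y
    · exact le_rfl
  have hFm : ∀ δ q, Measurable fun y => F δ q y := by
    intro δ q
    have hf : Measurable fun y : Config (N + 1) (Fin 3) T3 =>
        ‖(Torus.geometry (Fin 3)).sepVec (y q.1).1 (y q.2).1‖ :=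
      (Torus.measurable_geometry_sepVec.comp
        ((measurable_pi_apply q.1).fst.prodMk (measurable_pi_apply q.2).fst)).norm
    have hg : Measurable fun y : Config (N + 1) (Fin 3) T3 => ‖(y q.1).2 - (y q.2).2‖ :=
      ((measurable_pi_apply q.1).snd.sub (measurable_pi_apply q.2).snd).norm
    simp only [hF]
    exact Measurable.ite ((MeasurableSet.const _).inter ((measurableSet_le measurable_const hf).inter
      (measurableSet_le hf ((hg.const_mul δ).const_add _)))) (hwtm q) measurable_const
  have hB : ∀ δ : ℝ, 0 ≤ δ → ∀ q : Fin (N + 1) × Fin (N + 1),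
      ∫⁻ y, ENNReal.ofReal (F δ q y) ∂G ≤
        ENNReal.ofReal (hsDiameter σ N *
          (A * Real.exp (-(a * V ^ 2)) * hsDiameter σ N ^ 2 * δ + C₂ * δ ^ 2)) := by
    intro δ hδ q
    by_cases hq : q.1 = q.2
    · have h0 : ∀ y, F δ q y = 0 := fun y => by
        simp only [hF]
        exact if_neg fun hc => hc.1 hq
      simp only [h0, ENNReal.ofReal_zero, lintegral_zero, zero_le]
    · refine (lintegral_mono fun y => le_of_eq ?_).trans (Hs q.1 q.2 hq V hV δ hδ)
      simp only [hF, hwt, ne_eq, hq, not_false_eq_true, true_and]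
  -- Step 1: the hypotheses of the pathwise marked Korolyuk inequality hold almost surely
  have hH1 := ae_freeExitTime_lambertStateAfter_pos hσ hσ' N G hGac
  have hH2 := ae_nonAccumulation_of_absolutelyContinuous hσ hσ' N G hGac
  have hH3 : ∀ᵐ p ∂μ, p.1 ∈ hardSphereDomain (Torus.geometry (Fin 3)) (N + 1) (hsDiameter σ N) ∧
      ∀ k, freeExitTime (Torus.geometry (Fin 3)) (hsDiameter σ N)
          (lambertStateAfter (Torus.geometry (Fin 3)) (hsDiameter σ N) p.2 p.1 k) ≠ ⊤ →
        IsSimpleIncoming (Torus.geometry (Fin 3)) (hsDiameter σ N)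
          (freeFlight (Torus.geometry (Fin 3))
            (freeExitTime (Torus.geometry (Fin 3)) (hsDiameter σ N)
              (lambertStateAfter (Torus.geometry (Fin 3)) (hsDiameter σ N) p.2 p.1 k)).toReal
            (lambertStateAfter (Torus.geometry (Fin 3)) (hsDiameter σ N) p.2 p.1 k)) := by
    have h0 := (Measure.quasiMeasurePreserving_fst
      (μ := liouville (Torus.geometry (Fin 3)) (N + 1) (hsDiameter σ N)) (ν := lambertNoise (Fin 3))).ae
      (ae_liouville_mem_and_not_mem_contactSet (N := N + 1) hε.ne')
    refine (hGac.prod Measure.AbsolutelyContinuous.rfl).ae_le ?_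
    filter_upwards [LambertianContactSwapLambertianEulerFwdGood.lambert_ae_fwdGood hε hε' (N := N + 1), h0]
      with p hp hp0
    exact ⟨hp0.1, hp.1⟩
  -- Step 2: the mesh sums `R n` of the window, their measurability and their means
  -- `∫⁻ R n dμ ≤ (N+1)² ε (A e^{-aV²} ε² h + C₂ h² / (n+1)) =: bnd n → (N+1)² ε³ A e^{-aV²} h`
  set R : ℕ → Config (N + 1) (Fin 3) T3 × (ℕ → V3) → ℝ≥0∞ := fun n p => ENNReal.ofReal
    (∑ j ∈ Finset.range (n + 1), ∑ q : Fin (N + 1) × Fin (N + 1),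
      F (h / ((n : ℝ) + 1)) q (lambertFlow (Torus.geometry (Fin 3)) (hsDiameter σ N) p.2 p.1
        (a' + (j : ℝ) * (h / ((n : ℝ) + 1))))) with hR
  have hRm : ∀ n, Measurable (R n) := fun n =>
    (measurable_meshSum hσ.le hσ' N (hFm _) (fun j : ℕ => a' + (j : ℝ) * (h / ((n : ℝ) + 1))) n).ennreal_ofReal
  set bnd : ℕ → ℝ≥0∞ := fun n => ENNReal.ofReal (((N : ℝ) + 1) ^ 2 * (hsDiameter σ N *
    (A * Real.exp (-(a * V ^ 2)) * hsDiameter σ N ^ 2 * h + C₂ * h ^ 2 * (1 / ((n : ℝ) + 1))))) with hbnd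
  have h3 : ∀ n : ℕ, ∫⁻ p, R n p ∂μ ≤ bnd n := by
    intro n
    have hn : (0 : ℝ) < (n : ℝ) + 1 := by positivity
    have hδ : 0 ≤ h / ((n : ℝ) + 1) := div_nonneg hh.le hn.le
    refine (lintegral_meshSum_le hσ hσ' N b ϑ w hb hϑ Φ (hF0 _) (hFm _) (hB _ hδ)
      (s := fun j : ℕ => a' + (j : ℝ) * (h / ((n : ℝ) + 1)))
      (fun j => add_nonneg ha' (mul_nonneg (Nat.cast_nonneg _) hδ)) n).trans_eq ?_
    rw [hbnd]
    congr 1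
    field_simp
  have h4 : Tendsto bnd atTop (𝓝 (ENNReal.ofReal (((N : ℝ) + 1) ^ 2 * (hsDiameter σ N *
      (A * Real.exp (-(a * V ^ 2)) * hsDiameter σ N ^ 2 * h + C₂ * h ^ 2 * 0))))) :=
    ENNReal.tendsto_ofReal (Tendsto.const_mul _ (Tendsto.const_mul _ (tendsto_const_nhds.add
      (tendsto_one_div_add_atTop_nhds_zero_nat.const_mul _))))
  have hε3 : ((N : ℝ) + 1) * hsDiameter σ N ^ 3 = σ ^ 3 := by
    have e := succ_mul_hsDiameter_pow_three σ N
    push_cast at e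
    exact e
  -- Step 3: M1 almost surely (through the monotone `ofReal`), Fatou, and the assembly
  refine (lintegral_mono_ae (g := fun p => liminf (fun n => R n p) atTop) ?_).trans ?_
  · filter_upwards [hH1, hH2, hH3] with p h1 h2 h3
    refine le_liminf_of_le ?_ ?_
    · isBoundedDefault
    exact (markedContacts_le_meshSum hσ hσ' N p.1 p.2 h3.1 h1 h2 h3.2 wt hwt0 hwtv a' h ha' hh).mono
      fun n hn => ENNReal.ofReal_le_ofReal hn
  · calc ∫⁻ p, liminf (fun n => R n p) atTop ∂μ
        ≤ liminf (fun n => ∫⁻ p, R n p ∂μ) atTop := lintegral_liminf_le hRm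
      _ ≤ liminf bnd atTop := liminf_le_liminf (Eventually.of_forall h3)
      _ = _ := h4.liminf_eq
      _ = ENNReal.ofReal (A * Real.exp (-(a * V ^ 2)) * σ ^ 3 * h * ((N : ℝ) + 1)) := by
          congr 1
          rw [mul_zero, add_zero]
          linear_combination (A * Real.exp (-(a * V ^ 2)) * h * ((N : ℝ) + 1)) * hε3

end Summit.AtomisticToContinuum.HydrodynamicLimit.Theorems.LambertianContactSwapLambertianEulerFastPairActivity

end
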